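import Summits.ValiantsHypothesis.ValiantsHypothesis.Theorems.KPlusLogSqLawTropicalBComparabilityNested

/-!
# `TropicalB` (stmt-ValiantsHypothesis-19771) — three-register comparability chains: THE OUTER REGISTERS ARE JOINTLY LINEAR
# (along a dominant chain, the steps that keep the middle cell number `≤ 3(N·L₁ + U·L₂)`; all super-linear excess is middle churn)

Helper file for the crux `Theses.KPlusLogSqLaw.TropicalB` (`--supports stmt-ValiantsHypothesis-19771 --as helper`), cell
`pub-symmetroid`, seat val-sym-trop-p2 (g7).  HONEST FRAMING: a structure theorem about a SUB-FAMILY of the terms of an ARBITRARY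
design, hypotheses verbatim those of the THREE-LINK COMPARABILITY LAW (`ComparabilityChain.card_dominant_le_three`, val-sym-trop-p2 g5,
p490014/p490294; exchange lemmas `u_lt_of_dominant` / `w_lt_of_dominant` from `…ComparabilityNested`, p500459, imported): three registers `(j,y)`, `(a,b)`, `(p,u)` with additive slopes and valuations, coupled only through
`y < a`, `b < p`.  The family lives inside the Hessenberg sector, where `TropicalB` holds; nothing here bears on `TropicalB` in its
window, on `WeakLifting`, on `MatrixDescartes` (stmt-ValiantsHypothesis-18050) or on VP ≠ VNP.

## Statement (`card_sameMiddle_le`, `length_le_middleChanges`)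
Let `P₀, …, Pₙ` be members dominant at integer slopes `θ₀ < θ₁ < … < θₙ` (any such sequence — consecutive break points or not).
Then the number of steps `k → k+1` at which the MIDDLE CELL `(a, b)` does NOT change is at most `3(N·L₁ + U·L₂)`; hence
`n ≤ 3(N·L₁ + U·L₂) + #{k : (a_k, b_k) ≠ (a_{k+1}, b_{k+1})}`.

WHY IT MATTERS (located context, memo HOME/val-sym-trop-p2/g7/CUBIC-ABSTRACT.md): the family carries up to `U·L₁·L₂` dominant
members (the kernel cubic law p500874 is tight up to its constant), and in the extremal tables essentially EVERY step changes the
middle cell; this file shows that this is forced — the two outer registers together contribute only `O(N·L₁ + U·L₂)` steps, so any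
super-linear count is middle-cell churn.  It sharpens the ROW-SUM law p505983 (first register additive) to both outer registers at
once, along chains.

## Proof (Gajjar–Radhakrishnan's «in-edge of a middle vertex changes ≤ 2 times», with multiplicities)
A same-middle step changes the first-register state `(j,y)` or the third-register state `(p,u)`.  First register:
* SAME position `y`, new line `j'` (`card_sameY_le`): the map `k ↦ (j_{k+1}, y)` is injective — if the line `(j', y)` became current
  at two steps `k < k'`, then at the three slopes `θ_{k+1} < θ_{k'} < θ_{k'+1}` the lines `(j', y)` and `(j_{k'}, y)` (same position,
  always exchangeable) compare `>`, `<`, `>`: impossible for two lines.  `≤ N·L₁`.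
* NEW position (`card_newY_le`): let `w = max(y_k, y_{k+1})`; charge the step to `(w, side, line at position w)`.  Two steps with
  the same charge give slopes `θ₁ < θ₂ < θ₃` at which the line `(j, w)` is used, then a line at a position `< w` while `w < a`, then
  `(j, w)` again — the three exchanges are feasible exactly because `w` stays below the middle row — impossible.  `≤ 2·N·L₁`.
The third register is the mirror image (`card_sameP_le`, `card_newP_le`).  [folklore-level; the charging is Claim 52 of
Gajjar–Radhakrishnan, «Parametric shortest paths in planar graphs», 2018, App. B]
-/

set_option linter.dupNamespace false
set_option autoImplicit false

namespace Summit.ValiantsHypothesis.ValiantsHypothesis.Theorems.KPlusLogSqLaw.ComparabilityChain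

open Summit.ValiantsHypothesis.ValiantsHypothesis.Theorems.MatrixDescartes.Negative
open Finset

/-- three values of a linear function cannot have the sign pattern `+ − +` at increasing arguments. [folklore] -/
theorem not_pos_neg_pos {σ α θ₁ θ₂ θ₃ : ℤ} (h12 : θ₁ < θ₂) (h23 : θ₂ < θ₃)
    (h1 : 0 < θ₁ * σ - α) (h2 : θ₂ * σ - α < 0) (h3 : 0 < θ₃ * σ - α) : False := by
  rcases le_or_gt σ 0 with hs | hs
  · nlinarith
  · nlinarith

section Family

variable {m K N L₁ L₂ U : ℕ}
  (d : Fin K → ℕ) (v ε : Fin m → Fin m → Fin K → ℤ)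
  (τ : Fin N → Fin L₁ → Fin L₁ → Fin L₂ → Fin L₂ → Fin U → Equiv.Perm (Fin m) × (Fin m → Fin K))
  (s₁ : Fin N → Fin L₁ → ℤ) (s₂ : Fin L₁ → Fin L₂ → ℤ) (s₃ : Fin L₂ → Fin U → ℤ)
  (A : Fin N → Fin L₁ → ℤ) (W : Fin L₁ → Fin L₂ → ℤ) (B : Fin L₂ → Fin U → ℤ)
  (hinj : ∀ j y a b p u j' y' a' b' p' u', y < a → b < p → y' < a' → b' < p' →
    τ j y a b p u = τ j' y' a' b' p' u' → j = j' ∧ y = y' ∧ a = a' ∧ b = b' ∧ p = p' ∧ u = u')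
  (hpres : ∀ j y a b p u, y < a → b < p → termSign ε (τ j y a b p u) ≠ 0)
  (hw : ∀ j y a b p u (θ : ℤ), y < a → b < p →
    tropWeight d v θ (τ j y a b p u) = θ * (s₁ j y + s₂ a b + s₃ p u) - (A j y + W a b + B p u))

variable {n : ℕ} (θ : Fin (n + 1) → ℤ) (jj : Fin (n + 1) → Fin N) (yy aa : Fin (n + 1) → Fin L₁)
  (bb pp : Fin (n + 1) → Fin L₂) (uu : Fin (n + 1) → Fin U)
  (hθ : StrictMono θ) (hfeas : ∀ k, yy k < aa k ∧ bb k < pp k)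
  (hdom : ∀ k, IsDominant d v ε (θ k) (τ (jj k) (yy k) (aa k) (bb k) (pp k) (uu k)))

include hinj hpres hw hθ hfeas hdom in
/-- **No `+ − +` for a first-register line at a fixed position:** if the line `(j, y)` is the first register at times `t₁` and
`t₃`, and at a time `t₂` strictly between the first register is another state `(j₂, y₂)` with `y₂ < a_{t₁}`, `y₂ < a_{t₃}` and
`y < a_{t₂}` (all three swaps feasible), contradiction. -/
theorem no_return_x {t₁ t₂ t₃ : Fin (n + 1)} (h12 : t₁ < t₂) (h23 : t₂ < t₃)
    (hj : jj t₁ = jj t₃) (hy : yy t₁ = yy t₃) (hne : ¬ (jj t₂ = jj t₁ ∧ yy t₂ = yy t₁))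
    (f1 : yy t₂ < aa t₁) (f2 : yy t₁ < aa t₂) (f3 : yy t₂ < aa t₃) : False := by
  have e1 := u_lt_of_dominant d v ε τ s₁ s₂ s₃ A W B hinj hpres hw (hfeas t₁).1 (hfeas t₁).2 f1 (hdom t₁) (j' := jj t₂)
    (by rintro ⟨a1, a2⟩; exact hne ⟨a1.symm, a2.symm⟩)
  have e2 := u_lt_of_dominant d v ε τ s₁ s₂ s₃ A W B hinj hpres hw (hfeas t₂).1 (hfeas t₂).2 f2 (hdom t₂) (j' := jj t₁) hne
  have e3 := u_lt_of_dominant d v ε τ s₁ s₂ s₃ A W B hinj hpres hw (hfeas t₃).1 (hfeas t₃).2 f3 (hdom t₃) (j' := jj t₂)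
    (by rintro ⟨a1, a2⟩; exact hne ⟨a1.symm.trans hj.symm, a2.symm.trans hy.symm⟩)
  rw [← hj, ← hy] at e3
  exact not_pos_neg_pos (hθ h12) (hθ h23)
    (σ := s₁ (jj t₁) (yy t₁) - s₁ (jj t₂) (yy t₂)) (α := A (jj t₁) (yy t₁) - A (jj t₂) (yy t₂))
    (by linarith) (by linarith) (by linarith)

include hinj hpres hw hθ hfeas hdom in
/-- mirror: no `+ − +` for a third-register line. -/
theorem no_return_z {t₁ t₂ t₃ : Fin (n + 1)} (h12 : t₁ < t₂) (h23 : t₂ < t₃)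
    (hu : uu t₁ = uu t₃) (hp : pp t₁ = pp t₃) (hne : ¬ (pp t₂ = pp t₁ ∧ uu t₂ = uu t₁))
    (f1 : bb t₁ < pp t₂) (f2 : bb t₂ < pp t₁) (f3 : bb t₃ < pp t₂) : False := by
  have e1 := w_lt_of_dominant d v ε τ s₁ s₂ s₃ A W B hinj hpres hw (hfeas t₁).1 (hfeas t₁).2 f1 (hdom t₁) (u' := uu t₂)
    (by rintro ⟨a1, a2⟩; exact hne ⟨a1.symm, a2.symm⟩)
  have e2 := w_lt_of_dominant d v ε τ s₁ s₂ s₃ A W B hinj hpres hw (hfeas t₂).1 (hfeas t₂).2 f2 (hdom t₂) (u' := uu t₁) hne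
  have e3 := w_lt_of_dominant d v ε τ s₁ s₂ s₃ A W B hinj hpres hw (hfeas t₃).1 (hfeas t₃).2 f3 (hdom t₃) (u' := uu t₂)
    (by rintro ⟨a1, a2⟩; exact hne ⟨a1.symm.trans hp.symm, a2.symm.trans hu.symm⟩)
  rw [← hu, ← hp] at e3
  exact not_pos_neg_pos (hθ h12) (hθ h23)
    (σ := s₃ (pp t₁) (uu t₁) - s₃ (pp t₂) (uu t₂)) (α := B (pp t₁) (uu t₁) - B (pp t₂) (uu t₂))
    (by linarith) (by linarith) (by linarith)

open scoped Classical in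
include hinj hpres hw hθ hfeas hdom in
/-- **Same position, new line (first register): at most `N·L₁` such steps.**  The map `k ↦ (j_{k+1}, y_{k+1})` is injective on the
steps at which the first register keeps its position and changes its line. -/
theorem card_sameY_le :
    ((Finset.univ : Finset (Fin n)).filter (fun k => yy k.castSucc = yy k.succ ∧ jj k.castSucc ≠ jj k.succ)).card ≤ N * L₁ := by
  classical
  set S := (Finset.univ : Finset (Fin n)).filter (fun k => yy k.castSucc = yy k.succ ∧ jj k.castSucc ≠ jj k.succ) with hS
  have h := Finset.card_le_card_of_injOn (s := S) (t := (Finset.univ : Finset (Fin N × Fin L₁)))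
    (fun k => (jj k.succ, yy k.succ)) (fun _ _ => Finset.mem_coe.2 (Finset.mem_univ _)) ?_
  · simpa [Finset.card_univ, Fintype.card_prod, Fintype.card_fin] using h
  intro k hk k' hk' heq
  have hk₁ := (Finset.mem_filter.1 (Finset.mem_coe.1 hk)).2
  have hk₂ := (Finset.mem_filter.1 (Finset.mem_coe.1 hk')).2
  simp only [Prod.mk.injEq] at heq
  obtain ⟨ej, ey⟩ := heq
  by_contra hne
  -- order the two steps
  rcases lt_or_gt_of_ne hne with hlt | hlt
  · -- k < k': times k.succ ≤ k'.castSucc < k'.succ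
    rcases eq_or_lt_of_le (show k.succ ≤ k'.castSucc from by
        rw [Fin.le_def, Fin.val_succ, Fin.val_castSucc]; exact hlt) with heq' | hlt'
    · apply hk₂.2
      rw [← heq', ej]
    · exact no_return_x d v ε τ s₁ s₂ s₃ A W B hinj hpres hw θ jj yy aa bb pp uu hθ hfeas hdom hlt'
        (Fin.castSucc_lt_succ) ej ey
        (by rintro ⟨a1, a2⟩; exact hk₂.2 (a1.trans ej))
        (by rw [hk₂.1, ← ey]; exact (hfeas k.succ).1)
        (by rw [ey, ← hk₂.1]; exact (hfeas k'.castSucc).1)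
        (by rw [hk₂.1]; exact (hfeas k'.succ).1)
  · rcases eq_or_lt_of_le (show k'.succ ≤ k.castSucc from by
        rw [Fin.le_def, Fin.val_succ, Fin.val_castSucc]; exact hlt) with heq' | hlt'
    · apply hk₁.2
      rw [← heq', ← ej]
    · exact no_return_x d v ε τ s₁ s₂ s₃ A W B hinj hpres hw θ jj yy aa bb pp uu hθ hfeas hdom hlt'
        (Fin.castSucc_lt_succ) ej.symm ey.symm
        (by rintro ⟨a1, a2⟩; exact hk₁.2 (a1.trans ej.symm))
        (by rw [hk₁.1, ey]; exact (hfeas k'.succ).1)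
        (by rw [← ey, ← hk₁.1]; exact (hfeas k.castSucc).1)
        (by rw [hk₁.1]; exact (hfeas k.succ).1)

open scoped Classical in
include hinj hpres hw hθ hfeas hdom in
/-- **New position (first register): at most `2·N·L₁` such steps**, among the steps whose two first-register positions both lie
below both middle rows (`y_k < a_{k+1}`, `y_{k+1} < a_k` — automatic when the middle cell is kept).  Charge the step to
`(side, line at w, w)` with `w = max(y_k, y_{k+1})`; the charge is injective (`no_return_x`). -/
theorem card_newY_le :
    ((Finset.univ : Finset (Fin n)).filter (fun k => yy k.castSucc ≠ yy k.succ ∧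
        yy k.castSucc < aa k.succ ∧ yy k.succ < aa k.castSucc)).card ≤ 2 * (N * L₁) := by
  classical
  set S := (Finset.univ : Finset (Fin n)).filter (fun k => yy k.castSucc ≠ yy k.succ ∧
        yy k.castSucc < aa k.succ ∧ yy k.succ < aa k.castSucc) with hS
  -- the charge: side = true iff the larger position is the EARLIER endpoint
  let ch : Fin n → Bool × Fin N × Fin L₁ := fun k =>
    if yy k.succ < yy k.castSucc then (true, jj k.castSucc, yy k.castSucc) else (false, jj k.succ, yy k.succ)
  have h := Finset.card_le_card_of_injOn (s := S) (t := (Finset.univ : Finset (Bool × Fin N × Fin L₁))) ch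
    (fun _ _ => Finset.mem_coe.2 (Finset.mem_univ _)) ?_
  · simpa [Finset.card_univ, Fintype.card_prod, Fintype.card_fin, Fintype.card_bool] using h
  -- it suffices to exclude two steps `k < k'` with the same charge
  suffices key : ∀ k ∈ S, ∀ k' ∈ S, ch k = ch k' → k < k' → False by
    intro k hk k' hk' heq
    by_contra hne
    rcases lt_or_gt_of_ne hne with h | h
    · exact key k (Finset.mem_coe.1 hk) k' (Finset.mem_coe.1 hk') heq h
    · exact key k' (Finset.mem_coe.1 hk') k (Finset.mem_coe.1 hk) heq.symm h
  intro k hk k' hk' heq hlt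
  have hk₁ := (Finset.mem_filter.1 hk).2
  have hk₂ := (Finset.mem_filter.1 hk').2
  have hle : k.succ ≤ k'.castSucc := by
    rw [Fin.le_def, Fin.val_succ, Fin.val_castSucc]; exact hlt
  simp only [ch] at heq
  by_cases hs : yy k.succ < yy k.castSucc
  · rw [if_pos hs] at heq
    by_cases hs' : yy k'.succ < yy k'.castSucc
    · rw [if_pos hs'] at heq
      simp only [Prod.mk.injEq, true_and] at heq
      obtain ⟨ej, ey⟩ := heq
      -- `(j, w)` at `k.castSucc` and at `k'.castSucc`; at `k.succ` the position is smaller than `w`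
      rcases eq_or_lt_of_le hle with heq' | hlt'
      · have e : yy k.succ = yy k'.castSucc := by rw [heq']
        rw [← ey] at e
        exact absurd e (ne_of_lt hs)
      · refine no_return_x d v ε τ s₁ s₂ s₃ A W B hinj hpres hw θ jj yy aa bb pp uu hθ hfeas hdom
          (Fin.castSucc_lt_succ (i := k)) hlt' ej ey ?_ ?_ hk₁.2.1 ?_
        · rintro ⟨-, a2⟩; exact absurd a2 (ne_of_lt hs)
        · exact lt_trans hs (hfeas k.castSucc).1
        · rw [ey] at hs; exact lt_trans hs (hfeas k'.castSucc).1
    · rw [if_neg hs'] at heq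
      simp only [Prod.mk.injEq] at heq
      exact Bool.noConfusion heq.1
  · rw [if_neg hs] at heq
    have hs₂ : yy k.castSucc < yy k.succ := lt_of_le_of_ne (not_lt.1 hs) hk₁.1
    by_cases hs' : yy k'.succ < yy k'.castSucc
    · rw [if_pos hs'] at heq
      simp only [Prod.mk.injEq] at heq
      exact Bool.noConfusion heq.1
    · rw [if_neg hs'] at heq
      simp only [Prod.mk.injEq, true_and] at heq
      obtain ⟨ej, ey⟩ := heq
      have hs₂' : yy k'.castSucc < yy k'.succ := lt_of_le_of_ne (not_lt.1 hs') hk₂.1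
      -- `(j, w)` at `k.succ` and at `k'.succ`; at `k'.castSucc` the position is smaller than `w`
      rcases eq_or_lt_of_le hle with heq' | hlt'
      · have e : yy k.succ = yy k'.castSucc := by rw [heq']
        rw [ey] at e
        exact absurd e.symm (ne_of_lt hs₂')
      · refine no_return_x d v ε τ s₁ s₂ s₃ A W B hinj hpres hw θ jj yy aa bb pp uu hθ hfeas hdom hlt'
          (Fin.castSucc_lt_succ (i := k')) ej ey ?_ ?_ ?_ hk₂.2.1
        · rintro ⟨-, a2⟩; exact absurd (a2.trans ey) (ne_of_lt hs₂')
        · rw [← ey] at hs₂'; exact lt_trans hs₂' (hfeas k.succ).1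
        · rw [ey]; exact hk₂.2.2

open scoped Classical in
include hinj hpres hw hθ hfeas hdom in
/-- mirror of `card_sameY_le` for the third register: at most `U·L₂` steps keep `p` and change the line `u`. -/
theorem card_sameP_le :
    ((Finset.univ : Finset (Fin n)).filter (fun k => pp k.castSucc = pp k.succ ∧ uu k.castSucc ≠ uu k.succ)).card ≤ U * L₂ := by
  classical
  set S := (Finset.univ : Finset (Fin n)).filter (fun k => pp k.castSucc = pp k.succ ∧ uu k.castSucc ≠ uu k.succ) with hS
  have h := Finset.card_le_card_of_injOn (s := S) (t := (Finset.univ : Finset (Fin U × Fin L₂)))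
    (fun k => (uu k.succ, pp k.succ)) (fun _ _ => Finset.mem_coe.2 (Finset.mem_univ _)) ?_
  · simpa [Finset.card_univ, Fintype.card_prod, Fintype.card_fin] using h
  suffices key : ∀ k ∈ S, ∀ k' ∈ S, uu k.succ = uu k'.succ → pp k.succ = pp k'.succ → k < k' → False by
    intro k hk k' hk' heq
    simp only [Prod.mk.injEq] at heq
    obtain ⟨eu, ep⟩ := heq
    by_contra hne
    rcases lt_or_gt_of_ne hne with h | h
    · exact key k (Finset.mem_coe.1 hk) k' (Finset.mem_coe.1 hk') eu ep h
    · exact key k' (Finset.mem_coe.1 hk') k (Finset.mem_coe.1 hk) eu.symm ep.symm h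
  intro k hk k' hk' eu ep hlt
  have hk₁ := (Finset.mem_filter.1 hk).2
  have hk₂ := (Finset.mem_filter.1 hk').2
  have hle : k.succ ≤ k'.castSucc := by
    rw [Fin.le_def, Fin.val_succ, Fin.val_castSucc]; exact hlt
  rcases eq_or_lt_of_le hle with heq' | hlt'
  · apply hk₂.2
    rw [← heq', eu]
  · refine no_return_z d v ε τ s₁ s₂ s₃ A W B hinj hpres hw θ jj yy aa bb pp uu hθ hfeas hdom hlt'
      (Fin.castSucc_lt_succ (i := k')) eu ep ?_ ?_ ?_ ?_
    · rintro ⟨-, a2⟩; exact hk₂.2 (a2.trans eu)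
    · rw [hk₂.1, ← ep]; exact (hfeas k.succ).2
    · rw [ep, ← hk₂.1]; exact (hfeas k'.castSucc).2
    · rw [hk₂.1]; exact (hfeas k'.succ).2

open scoped Classical in
include hinj hpres hw hθ hfeas hdom in
/-- mirror of `card_newY_le` for the third register: at most `2·U·L₂` steps change `p` with both third-register positions above
both middle columns (`b_k < p_{k+1}`, `b_{k+1} < p_k`). -/
theorem card_newP_le :
    ((Finset.univ : Finset (Fin n)).filter (fun k => pp k.castSucc ≠ pp k.succ ∧
        bb k.castSucc < pp k.succ ∧ bb k.succ < pp k.castSucc)).card ≤ 2 * (U * L₂) := by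
  classical
  set S := (Finset.univ : Finset (Fin n)).filter (fun k => pp k.castSucc ≠ pp k.succ ∧
        bb k.castSucc < pp k.succ ∧ bb k.succ < pp k.castSucc) with hS
  -- the charge: side = true iff the SMALLER position `w = min(p_k, p_{k+1})` is the earlier endpoint
  let ch : Fin n → Bool × Fin U × Fin L₂ := fun k =>
    if pp k.castSucc < pp k.succ then (true, uu k.castSucc, pp k.castSucc) else (false, uu k.succ, pp k.succ)
  have h := Finset.card_le_card_of_injOn (s := S) (t := (Finset.univ : Finset (Bool × Fin U × Fin L₂))) ch
    (fun _ _ => Finset.mem_coe.2 (Finset.mem_univ _)) ?_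
  · simpa [Finset.card_univ, Fintype.card_prod, Fintype.card_fin, Fintype.card_bool] using h
  suffices key : ∀ k ∈ S, ∀ k' ∈ S, ch k = ch k' → k < k' → False by
    intro k hk k' hk' heq
    by_contra hne
    rcases lt_or_gt_of_ne hne with h | h
    · exact key k (Finset.mem_coe.1 hk) k' (Finset.mem_coe.1 hk') heq h
    · exact key k' (Finset.mem_coe.1 hk') k (Finset.mem_coe.1 hk) heq.symm h
  intro k hk k' hk' heq hlt
  have hk₁ := (Finset.mem_filter.1 hk).2
  have hk₂ := (Finset.mem_filter.1 hk').2
  have hle : k.succ ≤ k'.castSucc := by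
    rw [Fin.le_def, Fin.val_succ, Fin.val_castSucc]; exact hlt
  simp only [ch] at heq
  by_cases hs : pp k.castSucc < pp k.succ
  · rw [if_pos hs] at heq
    by_cases hs' : pp k'.castSucc < pp k'.succ
    · rw [if_pos hs'] at heq
      simp only [Prod.mk.injEq, true_and] at heq
      obtain ⟨eu, ep⟩ := heq
      -- `(u, w)` at `k.castSucc` and at `k'.castSucc`; at `k.succ` the position is larger than `w`
      rcases eq_or_lt_of_le hle with heq' | hlt'
      · have e : pp k.succ = pp k'.castSucc := by rw [heq']
        rw [← ep] at e
        exact absurd e.symm (ne_of_lt hs)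
      · refine no_return_z d v ε τ s₁ s₂ s₃ A W B hinj hpres hw θ jj yy aa bb pp uu hθ hfeas hdom
          (Fin.castSucc_lt_succ (i := k)) hlt' eu ep ?_ hk₁.2.1 hk₁.2.2 ?_
        · rintro ⟨a1, -⟩; exact absurd a1.symm (ne_of_lt hs)
        · rw [ep] at hs; exact lt_trans (hfeas k'.castSucc).2 hs
    · rw [if_neg hs'] at heq
      simp only [Prod.mk.injEq] at heq
      exact Bool.noConfusion heq.1
  · rw [if_neg hs] at heq
    have hs₂ : pp k.succ < pp k.castSucc := lt_of_le_of_ne (not_lt.1 hs) (Ne.symm hk₁.1)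
    by_cases hs' : pp k'.castSucc < pp k'.succ
    · rw [if_pos hs'] at heq
      simp only [Prod.mk.injEq] at heq
      exact Bool.noConfusion heq.1
    · rw [if_neg hs'] at heq
      simp only [Prod.mk.injEq, true_and] at heq
      obtain ⟨eu, ep⟩ := heq
      have hs₂' : pp k'.succ < pp k'.castSucc := lt_of_le_of_ne (not_lt.1 hs') (Ne.symm hk₂.1)
      -- `(u, w)` at `k.succ` and at `k'.succ`; at `k'.castSucc` the position is larger than `w`
      rcases eq_or_lt_of_le hle with heq' | hlt'
      · have e : pp k.succ = pp k'.castSucc := by rw [heq']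
        rw [ep] at e
        exact absurd e (ne_of_lt hs₂')
      · refine no_return_z d v ε τ s₁ s₂ s₃ A W B hinj hpres hw θ jj yy aa bb pp uu hθ hfeas hdom hlt'
          (Fin.castSucc_lt_succ (i := k')) eu ep ?_ ?_ ?_ hk₂.2.2
        · rintro ⟨a1, -⟩; exact absurd (a1.trans ep) (ne_of_gt hs₂')
        · have h1 := (hfeas k.succ).2
          rw [ep] at h1
          exact lt_trans h1 hs₂'
        · rw [ep]; exact hk₂.2.1

open scoped Classical in
include hinj hpres hw hθ hfeas hdom in
/-- **THE OUTER REGISTERS ARE JOINTLY LINEAR.**  Along any sequence of pairwise-consecutive-distinct members dominant at strictly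
increasing slopes, the steps at which the middle cell `(a, b)` is kept number at most `3(N·L₁ + U·L₂)`. -/
theorem card_sameMiddle_le
    (hstep : ∀ k : Fin n, ¬ (jj k.castSucc = jj k.succ ∧ yy k.castSucc = yy k.succ ∧ aa k.castSucc = aa k.succ ∧
      bb k.castSucc = bb k.succ ∧ pp k.castSucc = pp k.succ ∧ uu k.castSucc = uu k.succ)) :
    ((Finset.univ : Finset (Fin n)).filter (fun k => aa k.castSucc = aa k.succ ∧ bb k.castSucc = bb k.succ)).card ≤
      3 * (N * L₁ + U * L₂) := by
  classical
  have h1 := card_sameY_le d v ε τ s₁ s₂ s₃ A W B hinj hpres hw θ jj yy aa bb pp uu hθ hfeas hdom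
  have h2 := card_newY_le d v ε τ s₁ s₂ s₃ A W B hinj hpres hw θ jj yy aa bb pp uu hθ hfeas hdom
  have h3 := card_sameP_le d v ε τ s₁ s₂ s₃ A W B hinj hpres hw θ jj yy aa bb pp uu hθ hfeas hdom
  have h4 := card_newP_le d v ε τ s₁ s₂ s₃ A W B hinj hpres hw θ jj yy aa bb pp uu hθ hfeas hdom
  have hcover : (Finset.univ : Finset (Fin n)).filter (fun k => aa k.castSucc = aa k.succ ∧ bb k.castSucc = bb k.succ) ⊆
      (Finset.univ : Finset (Fin n)).filter (fun k => yy k.castSucc = yy k.succ ∧ jj k.castSucc ≠ jj k.succ) ∪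
      (Finset.univ : Finset (Fin n)).filter (fun k => yy k.castSucc ≠ yy k.succ ∧
        yy k.castSucc < aa k.succ ∧ yy k.succ < aa k.castSucc) ∪
      (Finset.univ : Finset (Fin n)).filter (fun k => pp k.castSucc = pp k.succ ∧ uu k.castSucc ≠ uu k.succ) ∪
      (Finset.univ : Finset (Fin n)).filter (fun k => pp k.castSucc ≠ pp k.succ ∧
        bb k.castSucc < pp k.succ ∧ bb k.succ < pp k.castSucc) := by
    intro k hk
    obtain ⟨ha, hb⟩ := (Finset.mem_filter.1 hk).2
    simp only [Finset.mem_union, Finset.mem_filter, Finset.mem_univ, true_and]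
    by_cases hy : yy k.castSucc = yy k.succ
    · by_cases hj : jj k.castSucc = jj k.succ
      · by_cases hp : pp k.castSucc = pp k.succ
        · by_cases hu : uu k.castSucc = uu k.succ
          · exact absurd ⟨hj, hy, ha, hb, hp, hu⟩ (hstep k)
          · exact Or.inl (Or.inr ⟨hp, hu⟩)
        · refine Or.inr ⟨hp, ?_, ?_⟩
          · rw [hb]; exact (hfeas k.succ).2
          · rw [← hb]; exact (hfeas k.castSucc).2
      · exact Or.inl (Or.inl (Or.inl ⟨hy, hj⟩))
    · refine Or.inl (Or.inl (Or.inr ⟨hy, ?_, ?_⟩))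
      · rw [← ha]; exact (hfeas k.castSucc).1
      · rw [ha]; exact (hfeas k.succ).1
  calc _ ≤ _ := Finset.card_le_card hcover
    _ ≤ _ := Finset.card_union_le _ _
    _ ≤ _ := Nat.add_le_add_right (Finset.card_union_le _ _) _
    _ ≤ _ := Nat.add_le_add_right (Nat.add_le_add_right (Finset.card_union_le _ _) _) _
    _ ≤ N * L₁ + 2 * (N * L₁) + U * L₂ + 2 * (U * L₂) := by gcongr
    _ = 3 * (N * L₁ + U * L₂) := by ring

open scoped Classical in
include hinj hpres hw hθ hfeas hdom in
/-- **Corollary: the length of the sequence is at most `3(N·L₁ + U·L₂)` plus the number of MIDDLE-CELL CHANGES.**  All excess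
of a three-register comparability chain over the linear budget of its outer registers is middle churn. -/
theorem length_le_middleChanges
    (hstep : ∀ k : Fin n, ¬ (jj k.castSucc = jj k.succ ∧ yy k.castSucc = yy k.succ ∧ aa k.castSucc = aa k.succ ∧
      bb k.castSucc = bb k.succ ∧ pp k.castSucc = pp k.succ ∧ uu k.castSucc = uu k.succ)) :
    n ≤ 3 * (N * L₁ + U * L₂) +
      ((Finset.univ : Finset (Fin n)).filter (fun k => ¬ (aa k.castSucc = aa k.succ ∧ bb k.castSucc = bb k.succ))).card := by
  classical
  have h := card_sameMiddle_le d v ε τ s₁ s₂ s₃ A W B hinj hpres hw θ jj yy aa bb pp uu hθ hfeas hdom hstep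
  have hsplit := Finset.card_filter_add_card_filter_not
    (s := (Finset.univ : Finset (Fin n))) (fun k => aa k.castSucc = aa k.succ ∧ bb k.castSucc = bb k.succ)
  rw [Finset.card_univ, Fintype.card_fin] at hsplit
  omega

end Family

end Summit.ValiantsHypothesis.ValiantsHypothesis.Theorems.KPlusLogSqLaw.ComparabilityChain
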